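import Mathlib
import Literature.AlgebraicGeometry.Resolution.CobordantGame
import Literature.AlgebraicGeometry.Resolution.CobordantChartCoefficients
import Literature.RingTheory.TwoVariableSeries.Basic
import Summits.ResolutionOfSingularities.ResolutionOfSingularities.Theorems.WeightedInvariantLocalWeightedDropUnaryConeForm
import Summits.ResolutionOfSingularities.ResolutionOfSingularities.Theorems.WeightedInvariantLocalWeightedDropWildTerminalCalculus
import Summits.ResolutionOfSingularities.ResolutionOfSingularities.Theorems.WeightedInvariantLocalWeightedDropWildPurePowerClean

/-!
# `WeightedInvariant.LocalWeightedDrop`, line `hasse-ridge-face-selection`: the UNARY-CONE EXIT (E2) of the purely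
# inseparable sub-game — a successor `y^{p^e} + T(x')` with wide apex re-centres to a position

Crux item stmt-ResolutionOfSingularities-8899 `LocalWeightedDrop` (route `ResolutionOfSingularities/WeightedInvariant`),
serving the door `WeightedConstruction` stmt-ResolutionOfSingularities-0571.  [OURS · L1 W4.3, chain w43, stub worker 1
(gen 2): S3πM infrastructure, item (N2)/(E2) of the S3πM design note (the general-`q` analogue of stub-3's char-`2` cleaning
exit).  Not a statement of any manuscript; elementary (Frobenius + `MvPolynomial.funext`).]

Let `q = p^e`, `S = y^q + T(x₁,x₂)` with `ord T ≥ q` (`y = X (Fin.last 2)`).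
* `cone_eq_of_wide`: two independent translation-invariance vectors of the degree-`q` form of ANY `S ∈ k[[x₀,x₁,x₂]]` make it
  `λ · (ℓ · v)^q` as a function (`ℓ = c₁ × c₂`; copied from the proof of `UnaryConeForm.normalForm_of_wideApex`);
* `coeff_eq_zero_of_cone_frobenius`: in characteristic `p`, `λ (ℓ · v)^{p^e} = Σ_i λ ℓ_i^{p^e} v_i^{p^e}`, so every degree-`q`
  coefficient of `S` off the pure powers `x_i^q` vanishes;
* `mixed_coeff_eq_zero_of_wide`: for `S = y^q + T(x')`, the mixed degree-`q` coefficients `[x₁^a x₂^{q-a}] T` (`0 < a < q`)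
  vanish;
* `exists_recentre_of_wide` (`k` algebraically closed): hence `φ := -(α^{1/q} x₁ + β^{1/q} x₂)` (`α, β` the pure coefficients)
  gives `ord (T + φ^q) > q` — with `WildPurePower.won_purePower_recentre_iff`, the wide-apex successor is won iff the
  POSITION `y^q + (T + φ^q)` is.
* `won_of_order_eq_of_not_wide`: the complementary case is pure logic — a singular order-`d` germ whose cone is NOT wide is won
  from the two hypotheses every S3-piece carries (germs of order `< d`: apex-free exit `TangentConeCut.apexFreeStartsWon`;
  the axis hypothesis).
-/

set_option linter.dupNamespace false -- mandated namespace of this single-conjunct summit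

namespace Summit.ResolutionOfSingularities.ResolutionOfSingularities.Theorems

open Literature.AlgebraicGeometry.Resolution

namespace WildPurePower

open MvPowerSeries WildTerminal Literature.AlgebraicGeometry.Resolution.CobordantGame

variable {k : Type} [Field k]

/-- TWO INDEPENDENT INVARIANCE VECTORS MAKE THE DEGREE-`d` FORM A FUNCTION OF ONE COVECTOR: `in_d S (v) = λ · (ℓ · v)^d` with
`ℓ = c₁ × c₂ ≠ 0` (the first half of `UnaryConeForm.normalForm_of_wideApex`, recorded on its own). -/
theorem cone_eq_of_wide (S : MvPowerSeries (Fin 3) k) (d : ℕ) (c₁ c₂ : Fin 3 → k)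
    (hind : ∀ α β : k, α • c₁ + β • c₂ = 0 → α = 0 ∧ β = 0)
    (h₁ : ∀ v : Fin 3 → k, CobordantChart.initEval (fun _ : Fin 3 => 1) (v + c₁) d S =
      CobordantChart.initEval (fun _ : Fin 3 => 1) v d S)
    (h₂ : ∀ v : Fin 3 → k, CobordantChart.initEval (fun _ : Fin 3 => 1) (v + c₂) d S =
      CobordantChart.initEval (fun _ : Fin 3 => 1) v d S) :
    ∃ (la : k) (ℓ : Fin 3 → k), ℓ ≠ 0 ∧
      ∀ v : Fin 3 → k, CobordantChart.initEval (fun _ : Fin 3 => 1) v d S = la * dotProduct ℓ v ^ d := by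
  classical
  set ℓ : Fin 3 → k := crossProduct c₁ c₂ with hℓdef
  have hℓ : ℓ ≠ 0 := crossProduct_ne_zero_iff_linearIndependent.mpr (LinearIndependent.pair_iff.mpr hind)
  have hℓ₁ : dotProduct ℓ c₁ = 0 := by rw [dotProduct_comm]; exact dot_self_cross c₁ c₂
  have hℓ₂ : dotProduct ℓ c₂ = 0 := by rw [dotProduct_comm]; exact dot_cross_self c₁ c₂
  obtain ⟨i₀, hi₀⟩ := Function.ne_iff.mp hℓ
  set u : Fin 3 → k := Pi.single i₀ (ℓ i₀)⁻¹ with hudef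
  have hℓu : dotProduct ℓ u = 1 := by rw [hudef, dotProduct_single, mul_inv_cancel₀ hi₀]
  set R : Matrix (Fin 3) (Fin 3) k := ![u, c₁, c₂] with hRdef
  have hRdet : IsUnit R.det := by
    rw [hRdef, ← triple_product_eq_det, dotProduct_comm, hℓu]
    exact isUnit_one
  have hRTdet : IsUnit R.transpose.det := by rw [Matrix.det_transpose]; exact hRdet
  have hdecomp : ∀ v : Fin 3 → k, ∃ x : Fin 3 → k, v = x 0 • u + x 1 • c₁ + x 2 • c₂ := by
    intro v
    refine ⟨R.transpose⁻¹.mulVec v, ?_⟩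
    set x := R.transpose⁻¹.mulVec v with hx
    have hv : v = R.transpose.mulVec x := (AxisNormalize.mulVec_nonsing_inv_mulVec hRTdet v).symm
    rw [hv, Matrix.mulVec_transpose]
    funext j
    simp [Matrix.vecMul, dotProduct, Fin.sum_univ_three, hRdef]
  refine ⟨CobordantChart.initEval (fun _ : Fin 3 => 1) u d S, ℓ, hℓ, fun v => ?_⟩
  obtain ⟨x, rfl⟩ := hdecomp v
  rw [AxisNormalize.initEval_add_smul h₂, AxisNormalize.initEval_add_smul h₁, AxisNormalize.initEval_smul]
  simp only [dotProduct_add, dotProduct_smul, smul_eq_mul, hℓu, hℓ₁, hℓ₂, mul_one, mul_zero, add_zero]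
  rw [mul_comm]

/-- FROBENIUS ON THE CONE: if `in_q S (v) = λ (ℓ · v)^q` with `q = p^e` in characteristic `p` (`k` infinite), then every
degree-`q` coefficient of `S` off the three pure powers `x_i^q` vanishes. -/
theorem coeff_eq_zero_of_cone_frobenius [Infinite k] (p : ℕ) (hp : p.Prime) [CharP k p] (e : ℕ)
    (S : MvPowerSeries (Fin 3) k) (la : k) (ℓ : Fin 3 → k)
    (hcone : ∀ v : Fin 3 → k, CobordantChart.initEval (fun _ : Fin 3 => 1) v (p ^ e) S = la * dotProduct ℓ v ^ (p ^ e))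
    {E : Fin 3 →₀ ℕ} (hE : E.degree = p ^ e) (hpure : ∀ i : Fin 3, E ≠ Finsupp.single i (p ^ e)) :
    coeff E S = 0 := by
  classical
  haveI := Fact.mk hp
  set q := p ^ e with hq
  set A := (Finset.univ : Finset (Fin 3)).finsuppAntidiag q with hA
  set Q : MvPolynomial (Fin 3) k := ∑ α ∈ A, MvPolynomial.monomial α (coeff α S) with hQ
  have hQeq : Q = ∑ i : Fin 3, MvPolynomial.monomial (Finsupp.single i q) (la * ℓ i ^ q) := by
    refine MvPolynomial.funext fun v => ?_
    have hev : MvPolynomial.eval v Q = CobordantChart.initEval (fun _ : Fin 3 => 1) v q S := by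
      rw [ApexFreeOrderDrop.initEval_one_eq_sum, hQ, map_sum]
      refine Finset.sum_congr rfl fun α _ => ?_
      rw [MvPolynomial.eval_monomial, Finsupp.prod_pow]
    rw [hev, hcone, map_sum, dotProduct, Fin.sum_univ_three, Fin.sum_univ_three, hq, add_pow_char_pow, add_pow_char_pow]
    simp only [MvPolynomial.eval_monomial, Finsupp.prod_single_index, pow_zero, mul_pow]
    ring
  have hcoeff : Q.coeff E = coeff E S := by
    rw [hQ, MvPolynomial.coeff_sum, Finset.sum_eq_single E]
    · rw [MvPolynomial.coeff_monomial, if_pos rfl]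
    · intro α _ hne
      rw [MvPolynomial.coeff_monomial, if_neg hne]
    · intro hES
      exfalso
      apply hES
      rw [hA, Finset.mem_finsuppAntidiag, ← Finsupp.degree_eq_sum]
      exact ⟨hE, Finset.subset_univ _⟩
  rw [← hcoeff, hQeq, MvPolynomial.coeff_sum]
  refine Finset.sum_eq_zero fun i _ => ?_
  rw [MvPolynomial.coeff_monomial, if_neg (fun h => hpure i h.symm)]

/-- THE MIXED COEFFICIENTS OF A WIDE-APEX SUCCESSOR VANISH: for `S = y^q + T(x₁,x₂)`, `q = p^e`, with two independent
translation-invariance vectors of `in_q S`, every `[x₁^a x₂^{q-a}] T` with `0 < a < q` is `0`. -/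
theorem mixed_coeff_eq_zero_of_wide [Infinite k] (p : ℕ) (hp : p.Prime) [CharP k p] (e : ℕ)
    (T : MvPowerSeries (Fin 2) k) (c₁ c₂ : Fin 3 → k)
    (hind : ∀ α β : k, α • c₁ + β • c₂ = 0 → α = 0 ∧ β = 0)
    (h₁ : ∀ v : Fin 3 → k, CobordantChart.initEval (fun _ : Fin 3 => 1) (v + c₁) (p ^ e)
      ((X (Fin.last 2) : MvPowerSeries (Fin (2 + 1)) k) ^ (p ^ e) + rename (Fin.succAboveEmb (Fin.last 2)) T) =
      CobordantChart.initEval (fun _ : Fin 3 => 1) v (p ^ e)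
      ((X (Fin.last 2) : MvPowerSeries (Fin (2 + 1)) k) ^ (p ^ e) + rename (Fin.succAboveEmb (Fin.last 2)) T))
    (h₂ : ∀ v : Fin 3 → k, CobordantChart.initEval (fun _ : Fin 3 => 1) (v + c₂) (p ^ e)
      ((X (Fin.last 2) : MvPowerSeries (Fin (2 + 1)) k) ^ (p ^ e) + rename (Fin.succAboveEmb (Fin.last 2)) T) =
      CobordantChart.initEval (fun _ : Fin 3 => 1) v (p ^ e)
      ((X (Fin.last 2) : MvPowerSeries (Fin (2 + 1)) k) ^ (p ^ e) + rename (Fin.succAboveEmb (Fin.last 2)) T))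
    {a : ℕ} (ha0 : 0 < a) (haq : a < p ^ e) :
    coeff (Finsupp.single 0 a + Finsupp.single 1 (p ^ e - a)) T = 0 := by
  classical
  obtain ⟨la, ℓ, -, hcone⟩ := cone_eq_of_wide _ (p ^ e) c₁ c₂ hind h₁ h₂
  have h := coeff_eq_zero_of_cone_frobenius p hp e _ la ℓ hcone
    (E := Finsupp.embDomain (Fin.succAboveEmb (Fin.last 2)) (Finsupp.single 0 a + Finsupp.single 1 (p ^ e - a)) +
      Finsupp.single (Fin.last 2) 0) (by
      rw [TschirnhausForm.degree_emb_add_single, map_add, Finsupp.degree_single, Finsupp.degree_single]; omega) (by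
      intro i hEi
      have hl := DFunLike.congr_fun hEi (Fin.last 2)
      rw [TschirnhausForm.emb_add_single_last, Finsupp.single_apply] at hl
      have h0 := DFunLike.congr_fun hEi (Fin.castSucc 0)
      rw [TschirnhausForm.emb_add_single_castSucc, Finsupp.single_apply] at h0
      have h1 := DFunLike.congr_fun hEi (Fin.castSucc 1)
      rw [TschirnhausForm.emb_add_single_castSucc, Finsupp.single_apply] at h1
      simp only [Finsupp.add_apply, Finsupp.single_eq_same, Finsupp.single_eq_of_ne (show (1 : Fin 2) ≠ 0 by decide),
        Finsupp.single_eq_of_ne (show (0 : Fin 2) ≠ 1 by decide), add_zero, zero_add] at h0 h1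
      split_ifs at h0 h1 hl <;> omega)
  rwa [coeff_X_pow_add_rename, if_neg (by rintro ⟨h0, -⟩; exact absurd h0 (by have := hp.one_lt; positivity)),
    zero_add, if_pos rfl] at h

/-- THE UNARY-CONE EXIT (E2): over an algebraically closed field of characteristic `p`, a successor `y^q + T(x₁,x₂)`
(`q = p^e`, `ord T ≥ q`) whose degree-`q` form has two independent translation-invariance vectors RE-CENTRES TO A POSITION:
there is a linear `φ = -(m₁ x₁ + m₂ x₂)` (`m₁^q = [x₁^q] T`, `m₂^q = [x₂^q] T`) with `ord (T + φ^q) > q`; and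
`Won (y^q + T) ↔ Won (y^q + (T + φ^q))` by `won_purePower_recentre_iff`. -/
theorem exists_recentre_of_wide (p : ℕ) (hp : p.Prime) (k : Type) [Field k] [CharP k p] [IsAlgClosed k] (e : ℕ)
    (T : MvPowerSeries (Fin 2) k) (hT : ((p ^ e : ℕ) : ℕ∞) ≤ T.order) (c₁ c₂ : Fin 3 → k)
    (hind : ∀ α β : k, α • c₁ + β • c₂ = 0 → α = 0 ∧ β = 0)
    (h₁ : ∀ v : Fin 3 → k, CobordantChart.initEval (fun _ : Fin 3 => 1) (v + c₁) (p ^ e)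
      ((X (Fin.last 2) : MvPowerSeries (Fin (2 + 1)) k) ^ (p ^ e) + rename (Fin.succAboveEmb (Fin.last 2)) T) =
      CobordantChart.initEval (fun _ : Fin 3 => 1) v (p ^ e)
      ((X (Fin.last 2) : MvPowerSeries (Fin (2 + 1)) k) ^ (p ^ e) + rename (Fin.succAboveEmb (Fin.last 2)) T))
    (h₂ : ∀ v : Fin 3 → k, CobordantChart.initEval (fun _ : Fin 3 => 1) (v + c₂) (p ^ e)
      ((X (Fin.last 2) : MvPowerSeries (Fin (2 + 1)) k) ^ (p ^ e) + rename (Fin.succAboveEmb (Fin.last 2)) T) =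
      CobordantChart.initEval (fun _ : Fin 3 => 1) v (p ^ e)
      ((X (Fin.last 2) : MvPowerSeries (Fin (2 + 1)) k) ^ (p ^ e) + rename (Fin.succAboveEmb (Fin.last 2)) T)) :
    ∃ φ : MvPowerSeries (Fin 2) k, constantCoeff φ = 0 ∧ ((p ^ e : ℕ) : ℕ∞) < (T + φ ^ (p ^ e)).order ∧
      (CobordantGame.Won k (2 + 1) ((X (Fin.last 2) : MvPowerSeries (Fin (2 + 1)) k) ^ (p ^ e) +
          rename (Fin.succAboveEmb (Fin.last 2)) T) ↔
        CobordantGame.Won k (2 + 1) ((X (Fin.last 2) : MvPowerSeries (Fin (2 + 1)) k) ^ (p ^ e) +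
          rename (Fin.succAboveEmb (Fin.last 2)) (T + φ ^ (p ^ e)))) := by
  classical
  haveI := Fact.mk hp
  haveI : CharP (MvPowerSeries (Fin 2) k) p := Literature.RingTheory.TwoVariableSeries.charP_mvPowerSeries (Fin 2) p
  set q := p ^ e with hq
  have hq0 : 0 < q := pow_pos hp.pos e
  -- `q`-th roots of the two pure coefficients
  obtain ⟨m₀, hm₀⟩ := IsAlgClosed.exists_pow_nat_eq (coeff (Finsupp.single 0 q) T) hq0
  obtain ⟨m₁, hm₁⟩ := IsAlgClosed.exists_pow_nat_eq (coeff (Finsupp.single 1 q) T) hq0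
  refine ⟨-(C m₀ * X 0 + C m₁ * X 1), ?_, ?_, ?_⟩
  · rw [map_neg, map_add, map_mul, map_mul, constantCoeff_C, constantCoeff_X, constantCoeff_C, constantCoeff_X, mul_zero,
      mul_zero, add_zero, neg_zero]
  · -- `φ^q = -(α x₁^q + β x₂^q)`
    have hφq : (-(C m₀ * X 0 + C m₁ * X 1) : MvPowerSeries (Fin 2) k) ^ q =
        -(C (coeff (Finsupp.single 0 q) T) * X 0 ^ q + C (coeff (Finsupp.single 1 q) T) * X 1 ^ q) := by
      rw [neg_pow, hq, neg_one_pow_char_pow, add_pow_char_pow, ← hq, mul_pow, mul_pow, ← map_pow, ← map_pow, hm₀, hm₁]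
      ring
    rw [hφq]
    refine lt_of_lt_of_le (by exact_mod_cast Nat.lt_succ_self q) (nat_le_order fun E hE => ?_)
    rw [map_add, map_neg, map_add]
    have hE01 : E = Finsupp.single 0 (E 0) + Finsupp.single 1 (E 1) := by
      ext l; fin_cases l <;> simp
    have hdeg : E.degree = E 0 + E 1 := by simp [Finsupp.degree_eq_sum, Fin.sum_univ_two]
    have hc0 : coeff E (C (coeff (Finsupp.single 0 q) T) * (X 0 : MvPowerSeries (Fin 2) k) ^ q) =
        if E = Finsupp.single 0 q then coeff (Finsupp.single 0 q) T else 0 := by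
      rw [coeff_C_mul, coeff_X_pow]
      split_ifs <;> simp
    have hc1 : coeff E (C (coeff (Finsupp.single 1 q) T) * (X 1 : MvPowerSeries (Fin 2) k) ^ q) =
        if E = Finsupp.single 1 q then coeff (Finsupp.single 1 q) T else 0 := by
      rw [coeff_C_mul, coeff_X_pow]
      split_ifs <;> simp
    rw [hc0, hc1]
    by_cases hlt : E.degree < q
    · rw [coeff_of_lt_order (lt_of_lt_of_le (by exact_mod_cast hlt) hT), if_neg, if_neg, add_zero, neg_zero, add_zero]
      · rintro rfl; rw [Finsupp.degree_single] at hlt; exact lt_irrefl _ hlt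
      · rintro rfl; rw [Finsupp.degree_single] at hlt; exact lt_irrefl _ hlt
    · have hEq : E 0 + E 1 = q := by omega
      by_cases hE0 : E 0 = q
      · have hE : E = Finsupp.single 0 q := by rw [hE01, hE0, show E 1 = 0 by omega, Finsupp.single_zero, add_zero]
        rw [hE, if_pos rfl, if_neg (by
          intro h; have := DFunLike.congr_fun h 0; simp at this; omega), add_zero, add_neg_cancel]
      · by_cases hE00 : E 0 = 0
        · have hE : E = Finsupp.single 1 q := by rw [hE01, hE00, show E 1 = q by omega, Finsupp.single_zero, zero_add]
          rw [hE, if_neg (by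
            intro h; have := DFunLike.congr_fun h 0; simp at this; omega), if_pos rfl, zero_add, add_neg_cancel]
        · -- mixed exponent: the wide apex kills the coefficient of `T`
          have hmix := mixed_coeff_eq_zero_of_wide p hp e T c₁ c₂ hind h₁ h₂ (a := E 0) (Nat.pos_of_ne_zero hE00) (by omega)
          rw [show q - E 0 = E 1 by omega, ← hE01] at hmix
          rw [hmix, if_neg, if_neg, add_zero, neg_zero, add_zero]
          · intro h; have := DFunLike.congr_fun h 1; simp at this; omega
          · intro h; have := DFunLike.congr_fun h 0; simp at this; omega
  · exact (won_purePower_recentre_iff p hp e _ (by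
      rw [map_neg, map_add, map_mul, map_mul, constantCoeff_C, constantCoeff_X, constantCoeff_C, constantCoeff_X, mul_zero,
        mul_zero, add_zero, neg_zero]) T).symm

/-- THE COMPLEMENTARY EXITS ARE PURE LOGIC: a singular germ of order `d` whose degree-`d` form does NOT have two independent
translation-invariance vectors is won, given the germs of smaller order (apex-free exit, `TangentConeCut.apexFreeStartsWon`)
and the axis hypothesis of the S3 pieces (apex dimension exactly one). -/
theorem won_of_order_eq_of_not_wide (p : ℕ) (hp : p.Prime) (k : Type) [Field k] [CharP k p] {d : ℕ}
    (hord : ∀ g : MvPowerSeries (Fin 3) k, CobordantGame.IsSingular k g → g.order < d → CobordantGame.Won k 3 g)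
    (haxis : ∀ g : MvPowerSeries (Fin 3) k, CobordantGame.IsSingular k g → g.order = d →
      (∃ c : Fin 3 → k, c ≠ 0 ∧ ∀ v : Fin 3 → k,
        CobordantChart.initEval (fun _ : Fin 3 => 1) (v + c) d g = CobordantChart.initEval (fun _ : Fin 3 => 1) v d g) →
      (∀ c₁ c₂ : Fin 3 → k,
        (∀ v : Fin 3 → k, CobordantChart.initEval (fun _ : Fin 3 => 1) (v + c₁) d g =
          CobordantChart.initEval (fun _ : Fin 3 => 1) v d g) →
        (∀ v : Fin 3 → k, CobordantChart.initEval (fun _ : Fin 3 => 1) (v + c₂) d g =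
          CobordantChart.initEval (fun _ : Fin 3 => 1) v d g) →
        ∃ α β : k, (α ≠ 0 ∨ β ≠ 0) ∧ α • c₁ + β • c₂ = 0) →
      CobordantGame.Won k 3 g)
    (g : MvPowerSeries (Fin 3) k) (hg : CobordantGame.IsSingular k g) (hgd : g.order = d)
    (hnot : ¬ ∃ c₁ c₂ : Fin 3 → k, (∀ α β : k, α • c₁ + β • c₂ = 0 → α = 0 ∧ β = 0) ∧
      (∀ v : Fin 3 → k, CobordantChart.initEval (fun _ : Fin 3 => 1) (v + c₁) d g =
        CobordantChart.initEval (fun _ : Fin 3 => 1) v d g) ∧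
      (∀ v : Fin 3 → k, CobordantChart.initEval (fun _ : Fin 3 => 1) (v + c₂) d g =
        CobordantChart.initEval (fun _ : Fin 3 => 1) v d g)) :
    CobordantGame.Won k 3 g := by
  classical
  by_cases hax : ∃ c : Fin 3 → k, c ≠ 0 ∧ ∀ v : Fin 3 → k,
      CobordantChart.initEval (fun _ : Fin 3 => 1) (v + c) d g = CobordantChart.initEval (fun _ : Fin 3 => 1) v d g
  · -- apex of dimension exactly one
    refine haxis g hg hgd hax fun c₁ c₂ hc₁ hc₂ => ?_
    by_contra hdep
    apply hnot
    refine ⟨c₁, c₂, fun α β h => ?_, hc₁, hc₂⟩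
    by_contra hαβ
    exact hdep ⟨α, β, not_and_or.mp hαβ, h⟩
  · -- apex-free
    exact TangentConeCut.apexFreeStartsWon p hp k (by norm_num) g d hgd
      (fun g' hg' hlt => hord g' hg' (by rw [hgd] at hlt; exact hlt))
      fun c hc => not_forall.mp fun hall => hax ⟨c, hc, hall⟩

end WildPurePower

end Summit.ResolutionOfSingularities.ResolutionOfSingularities.Theorems
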